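import Literature.Probability.Percolation.ZdFourArmOutLandedExtProb
import Literature.Probability.Percolation.ZdFourArmSepInwardScheme
import HarnessLib

/-!
# Kesten's arm separation for four arms of bond percolation on `ℤ²`: the external multi-scale scheme

Topic `Literature/Probability/Percolation`; critical bond percolation on `ℤ²`
(`P = P_{1/2} = bondPercolation (zdGraph 2) half`). PROOFS ONLY (no definition, no named fact).

The EXTERNAL half of Kesten's arm-separation theorem (H. Kesten, CMP 109 (1987), §2, Lemma 4;
P. Nolin, EJP 13 (2008), §4.4, proof of Thm. 11, "1. External extremities" [arXiv 0711.4948: Thm. 10,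
p. 12]) run FIRST, on the plain four-arm event `fourArmTwoClusters n N` and ending in the outer-landed
event `zdFourArmOutLanded n N` (`ZdFourArmOutLanded.lean`), assembled from the tree's summation on the
doubling ladder `R_K = n · 2^K` (`real_fourArmTwoClusters_le_mul_of_scheme`,
`ZdFourArmSeparationStep.lean`) with

* the extension input `P(OutLanded n M) ≤ C₀ P(OutLanded n 2M)` —
  `exists_real_zdFourArmOutLanded_le_mul_outwardTo` (`ZdFourArmOutLandedExtProb.lean`), which also
  carries the result from the ladder to an arbitrary outer radius `N ∈ [2M, 4M]`;
* the initial-scale input `c ≤ P(OutLanded n 2n)` — `exists_le_real_zdFourArmSep_init`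
  (`ZdFourArmSepInitProb.lean`) with `zdFourArmSep ⊆ zdFourArmOutLanded`;
* the two remaining inputs DISPLAYED as the hypothesis of the theorems (no named fact): the outer
  surgery step `P(A₄(n, 2M)) ≤ P(G n 2M) + ε · P(A₄(n, M))` for every prescribed `ε > 0` (Nolin's
  Lemma 15 [arXiv 14] on the four side rectangles of `A(M, 2M)`; its reduction to a deterministic
  surgery off a bad event read outside `B(M)` is `real_fourArmTwoClusters_le_add_mul`) and the outer
  landing `P(G n M) ≤ C₁(ε) · P(zdFourArmOutLanded n 2M)` (Prop. 12 (iii) [arXiv 11 (iii)]).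

Results:

* `real_fourArmTwoClusters_ladder_le` — the summation along the ladder `n · 2^K`;
* **`exists_real_fourArmTwoClusters_le_mul_zdFourArmOutLanded`** — the external half
  `∃ C n₀, ∀ n ≥ n₀, ∀ N ≥ 2n, P(fourArmTwoClusters n N) ≤ C · P(zdFourArmOutLanded n N)` (the
  hypothesis `hout` of `zdFourArm_wellSeparated_of_halves`, `ZdFourArmSepInwardScheme.lean`) from the
  outer surgery-and-landing inputs;
* `zdFourArm_wellSeparated_of_outIn` — Kesten's display `(S)` from the outer and the inner
  surgery-and-landing inputs; `DuminilCopinManolescuTassion2021_zdFourArm_quasiMult_of_outIn`,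
  `Nolin2008_zdEdgeFourArmQuasiMult_of_outIn`.

## References

* P. Nolin, *Near-critical percolation in two dimensions*, EJP 13 (2008), §4.3 Prop. 12, §4.4 proof
  of Thm. 11 (arXiv 0711.4948: Prop. 11, Thm. 10, pp. 11–13) [Nolin2008].
* H. Kesten, *Scaling relations for 2D-percolation*, CMP 109 (1987), §2, Lemmas 4–5 [KestenScalingCMP1987].
* H. Duminil-Copin, I. Manolescu, V. Tassion, PTRF 181 (2021), §6.2 Prop. 6.2–6.3
  [DuminilCopinManolescuTassion2021].
-/

noncomputable section

open MeasureTheory Set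

namespace Literature.Probability.Percolation

open LatticeModels

/-! ### The summation along the outward ladder `n · 2^K` -/

/-- **The external multi-scale summation on the ladder `n · 2^K`** (`128 ≤ n`): given an event family
`G n ·` with the outer step `P(A₄(n, 2M)) ≤ P(G n 2M) + ε P(A₄(n, M))` (`n ≤ M`) and the outer landing
`P(G n M) ≤ C₁ P(OutLanded n 2M)` (`2n ≤ M`), and `ε C₀² ≤ 1/2` for the outward-extension constant
`C₀` of `zdFourArmOutLanded`, conclude `P(A₄(n, n 2^K)) ≤ (2C₁ + 1/c) P(OutLanded n (n 2^K))` for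
`1 ≤ K`, `c` the initial-scale constant. [cite: Nolin2008, §4.4, proof of Thm. 11, external extremities (arXiv 0711.4948: Thm. 10, p. 12)] [cite: KestenScalingCMP1987, §2 Lemma 4] -/
theorem real_fourArmTwoClusters_ladder_le {n : ℕ} (hn : 128 ≤ n)
    {G : ℕ → ℕ → Set (BondConfig (Site 2))} {ε C₀ C₁ c : ℝ}
    (hε : 0 ≤ ε) (hC₀ : 1 ≤ C₀) (hC₁ : 0 ≤ C₁) (hc : 0 < c) (hsmall : ε * C₀ ^ 2 ≤ 1 / 2)
    (hext : ∀ n' M : ℕ, 128 ≤ n' → 2 * n' ≤ M →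
      (bondPercolation (zdGraph 2) half).real (zdFourArmOutLanded n' M) ≤
        C₀ * (bondPercolation (zdGraph 2) half).real (zdFourArmOutLanded n' (2 * M)))
    (hinit : ∀ m N' : ℕ, 64 ≤ m → 2 * m ≤ N' → N' ≤ 8 * m →
      c ≤ (bondPercolation (zdGraph 2) half).real (zdFourArmSep m N'))
    (hstep : ∀ M : ℕ, n ≤ M →
      (bondPercolation (zdGraph 2) half).real (fourArmTwoClusters n (2 * M)) ≤
        (bondPercolation (zdGraph 2) half).real (G n (2 * M)) +
          ε * (bondPercolation (zdGraph 2) half).real (fourArmTwoClusters n M))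
    (hland : ∀ M : ℕ, 2 * n ≤ M →
      (bondPercolation (zdGraph 2) half).real (G n M) ≤
        C₁ * (bondPercolation (zdGraph 2) half).real (zdFourArmOutLanded n (2 * M))) :
    ∀ K, 1 ≤ K →
      (bondPercolation (zdGraph 2) half).real (fourArmTwoClusters n (n * 2 ^ K)) ≤
        (2 * C₁ + 1 / c) * (bondPercolation (zdGraph 2) half).real (zdFourArmOutLanded n (n * 2 ^ K)) := by
  set μ := bondPercolation (zdGraph 2) half with hμ
  have hsucc : ∀ K : ℕ, n * 2 ^ (K + 1) = 2 * (n * 2 ^ K) := fun K => by rw [pow_succ]; ring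
  have hge : ∀ K : ℕ, n ≤ n * 2 ^ K := fun K => Nat.le_mul_of_pos_right _ (Nat.two_pow_pos _)
  have hge2 : ∀ K : ℕ, 1 ≤ K → 2 * n ≤ n * 2 ^ K := by
    intro K hK
    calc 2 * n = n * 2 ^ 1 := by ring
      _ ≤ n * 2 ^ K := Nat.mul_le_mul_left _ (Nat.pow_le_pow_right (by norm_num) hK)
  have hinit1 : c ≤ μ.real (zdFourArmOutLanded n (n * 2 ^ (0 + 1))) := by
    rw [show n * 2 ^ (0 + 1) = 2 * n by ring]
    exact (hinit n (2 * n) (by omega) le_rfl (by omega)).trans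
      (measureReal_mono (zdFourArmSep_subset_zdFourArmOutLanded (by omega)) (measure_ne_top _ _))
  intro K hK
  exact real_fourArmTwoClusters_le_mul_of_scheme half (G := fun K => G n (n * 2 ^ K))
    (H := fun K => zdFourArmOutLanded n (n * 2 ^ K)) (k := 0) (L := K) hε hC₀ hC₁ hc hsmall (by omega)
    (fun K _ _ => by
      show μ.real (fourArmTwoClusters n (n * 2 ^ (K + 1))) ≤
        μ.real (G n (n * 2 ^ (K + 1))) + ε * μ.real (fourArmTwoClusters n (n * 2 ^ K))
      rw [hsucc K]
      exact hstep _ (hge K))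
    (fun K hK1 _ => by
      show μ.real (G n (n * 2 ^ K)) ≤ C₁ * μ.real (zdFourArmOutLanded n (n * 2 ^ (K + 1)))
      rw [hsucc K]
      exact hland _ (hge2 K (by omega)))
    (fun K hK1 _ => by
      show μ.real (zdFourArmOutLanded n (n * 2 ^ K)) ≤ C₀ * μ.real (zdFourArmOutLanded n (n * 2 ^ (K + 1)))
      rw [hsucc K]
      exact hext n _ hn (hge2 K (by omega)))
    hinit1 K (by omega) le_rfl

/-! ### The external half: `P(A₄(n, N)) ≤ C · P(OutLanded n N)` -/

/-- **The external half of Kesten's arm separation for four arms of bond percolation on `ℤ²`**: if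
for every `ε > 0` there are `C₁ ≥ 0`, `n₁` and events `G n M` with the outer step
`P(fourArmTwoClusters n 2M) ≤ P(G n 2M) + ε · P(fourArmTwoClusters n M)` (`n₁ ≤ n ≤ M`) and the outer
landing `P(G n M) ≤ C₁ · P(zdFourArmOutLanded n 2M)` (`n₁ ≤ n`, `2n ≤ M`), then
`∃ C n₀, ∀ n ≥ n₀, ∀ N ≥ 2n, P(fourArmTwoClusters n N) ≤ C · P(zdFourArmOutLanded n N)`. Arbitrary
outer radii are reached from the ladder by monotonicity of the four-arm event in its outer radius and
the outward extension `P(OutLanded n M) ≤ C₀ P(OutLanded n N)`, `N ∈ [2M, 4M]`. [cite: Nolin2008, §4.4, proof of Thm. 11, external extremities (arXiv 0711.4948: Thm. 10, p. 12)] [cite: KestenScalingCMP1987, §2 Lemma 4] -/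
theorem exists_real_fourArmTwoClusters_le_mul_zdFourArmOutLanded
    (hout : ∀ ε : ℝ, 0 < ε → ∃ (C₁ : ℝ) (n₁ : ℕ) (G : ℕ → ℕ → Set (BondConfig (Site 2))), 0 ≤ C₁ ∧
      (∀ n M : ℕ, n₁ ≤ n → n ≤ M →
        (bondPercolation (zdGraph 2) half).real (fourArmTwoClusters n (2 * M)) ≤
          (bondPercolation (zdGraph 2) half).real (G n (2 * M)) +
            ε * (bondPercolation (zdGraph 2) half).real (fourArmTwoClusters n M)) ∧
      (∀ n M : ℕ, n₁ ≤ n → 2 * n ≤ M →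
        (bondPercolation (zdGraph 2) half).real (G n M) ≤
          C₁ * (bondPercolation (zdGraph 2) half).real (zdFourArmOutLanded n (2 * M)))) :
    ∃ (C : ℝ) (n₀ : ℕ), 0 < C ∧ ∀ n N : ℕ, n₀ ≤ n → 2 * n ≤ N →
      (bondPercolation (zdGraph 2) half).real (fourArmTwoClusters n N) ≤
        C * (bondPercolation (zdGraph 2) half).real (zdFourArmOutLanded n N) := by
  set μ := bondPercolation (zdGraph 2) half with hμ
  obtain ⟨C₀, hC₀, hext⟩ := exists_real_zdFourArmOutLanded_le_mul_outwardTo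
  obtain ⟨c, hc, hinit⟩ := exists_le_real_zdFourArmSep_init
  have hε : 0 < 1 / (2 * C₀ ^ 2) := by positivity
  obtain ⟨C₁, n₁, G, hC₁, hstep, hland⟩ := hout (1 / (2 * C₀ ^ 2)) hε
  have hC₀0 : 0 < C₀ := by linarith
  refine ⟨max ((2 * C₁ + 1 / c) * C₀) (1 / c), max 128 n₁, by positivity, fun n N hn hN => ?_⟩
  have hn128 : 128 ≤ n := le_of_max_le_left hn
  have hn₁ : n₁ ≤ n := le_of_max_le_right hn
  have hsub : ∀ N', 2 * n ≤ N' → μ.real (zdFourArmSep n N') ≤ μ.real (zdFourArmOutLanded n N') := fun N' _ =>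
    measureReal_mono (zdFourArmSep_subset_zdFourArmOutLanded (by omega)) (measure_ne_top _ _)
  by_cases hN4 : N < 4 * n
  · -- bounded ratio: `P(A₄) ≤ 1 ≤ P(OutLanded n N) / c`
    have h1 : c ≤ μ.real (zdFourArmOutLanded n N) := (hinit n N (by omega) hN (by omega)).trans (hsub N hN)
    calc μ.real (fourArmTwoClusters n N) ≤ 1 := measureReal_le_one
      _ ≤ 1 / c * μ.real (zdFourArmOutLanded n N) := by
          rw [one_div_mul_eq_div, le_div_iff₀ hc, one_mul]; exact h1
      _ ≤ max ((2 * C₁ + 1 / c) * C₀) (1 / c) * μ.real (zdFourArmOutLanded n N) :=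
          mul_le_mul_of_nonneg_right (le_max_right _ _) measureReal_nonneg
  · -- the ladder up to `M = n 2^(K-1)`, `2M ≤ N < 4M`, then the outward extension from `M` to `N`
    have hN4 : 4 * n ≤ N := not_lt.1 hN4
    set t : ℕ := N / n with ht
    have hn0 : 0 < n := by omega
    have ht4 : 4 ≤ t := (Nat.le_div_iff_mul_le hn0).2 (by linarith)
    set K : ℕ := Nat.log 2 t with hK
    have hK1 : 2 ^ K ≤ t := Nat.pow_log_le_self 2 (by omega)
    have hK2 : t < 2 ^ (K + 1) := Nat.lt_pow_succ_log_self (by norm_num) t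
    have hKge : 2 ≤ K := by
      rw [hK]
      exact Nat.le_log_of_pow_le (by norm_num) (by simpa using ht4)
    have htN : n * t ≤ N := by rw [ht]; exact Nat.mul_div_le N n
    have hNt : N < n * (t + 1) := by rw [ht]; exact Nat.lt_mul_div_succ N hn0
    obtain ⟨j, hKj⟩ : ∃ j, K = j + 1 := ⟨K - 1, by omega⟩
    have hj : 1 ≤ j := by omega
    set M : ℕ := n * 2 ^ j with hM
    have h2M : 2 * M = n * 2 ^ K := by rw [hM, hKj, pow_succ]; ring
    have h4M : 4 * M = n * 2 ^ (K + 1) := by rw [hM, hKj, pow_succ, pow_succ]; ring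
    have hMlo : 2 * M ≤ N := by
      rw [h2M]; exact (Nat.mul_le_mul_left _ hK1).trans htN
    have hMhi : N ≤ 4 * M := by
      rw [h4M]
      exact hNt.le.trans (Nat.mul_le_mul_left _ hK2)
    have h2n : 2 * n ≤ M := by
      rw [hM]
      calc 2 * n = n * 2 ^ 1 := by ring
        _ ≤ n * 2 ^ j := Nat.mul_le_mul_left _ (Nat.pow_le_pow_right (by norm_num) hj)
    have hnM : n ≤ M := by omega
    have hsmall : 1 / (2 * C₀ ^ 2) * C₀ ^ 2 ≤ 1 / 2 := by
      rw [le_div_iff₀ (by norm_num : (0 : ℝ) < 2)]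
      have hC : (0 : ℝ) < C₀ ^ 2 := by positivity
      rw [div_mul_eq_mul_div, one_mul, div_mul_eq_mul_div, div_le_iff₀ (by positivity)]
      nlinarith
    have hladder := real_fourArmTwoClusters_ladder_le (G := G) hn128 hε.le hC₀ hC₁ hc hsmall
      (fun n' M' hn' h2 => hext n' M' (2 * M') hn' h2 le_rfl (by omega)) hinit
      (fun M' hM' => hstep n M' hn₁ hM') (fun M' hM' => hland n M' hn₁ hM') j hj
    rw [← hM] at hladder
    have hpos : 0 ≤ 2 * C₁ + 1 / c := by positivity
    calc μ.real (fourArmTwoClusters n N)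
        ≤ μ.real (fourArmTwoClusters n M) := real_fourArmTwoClusters_mono half le_rfl hnM (by omega)
      _ ≤ (2 * C₁ + 1 / c) * μ.real (zdFourArmOutLanded n M) := hladder
      _ ≤ (2 * C₁ + 1 / c) * (C₀ * μ.real (zdFourArmOutLanded n N)) :=
          mul_le_mul_of_nonneg_left (hext n M N hn128 h2n hMlo hMhi) hpos
      _ = (2 * C₁ + 1 / c) * C₀ * μ.real (zdFourArmOutLanded n N) := by ring
      _ ≤ max ((2 * C₁ + 1 / c) * C₀) (1 / c) * μ.real (zdFourArmOutLanded n N) :=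
          mul_le_mul_of_nonneg_right (le_max_left _ _) measureReal_nonneg

/-! ### Assembly: Kesten's display from the outer and inner surgery-and-landing inputs -/

/-- **Kesten's arm-separation display for four arms of bond percolation on `ℤ²` from the two
surgery-and-landing inputs**: the outer inputs of
`exists_real_fourArmTwoClusters_le_mul_zdFourArmOutLanded` (Nolin 2008, §4.4 "1. External extremities";
Kesten 1987, Lemma 4) and the inner inputs of `exists_real_zdFourArmOutLanded_le_mul_zdFourArmSep`
(Nolin 2008, §4.4 "2. Internal extremities"; Kesten 1987, Lemma 5) give
`∃ n₀ c > 0, ∀ n ≥ n₀, ∀ N ≥ 2n, c · P(fourArmTwoClusters n N) ≤ P(zdFourArmSep n N)`. [cite: Nolin2008, §4.4 Thm. 11 (arXiv 0711.4948: Thm. 10)] [cite: KestenScalingCMP1987, §2 Lemmas 4–5] [cite: DuminilCopinManolescuTassion2021, §6.2 Prop. 6.2, q = 1] -/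
theorem zdFourArm_wellSeparated_of_outIn
    (hout : ∀ ε : ℝ, 0 < ε → ∃ (C₁ : ℝ) (n₁ : ℕ) (G : ℕ → ℕ → Set (BondConfig (Site 2))), 0 ≤ C₁ ∧
      (∀ n M : ℕ, n₁ ≤ n → n ≤ M →
        (bondPercolation (zdGraph 2) half).real (fourArmTwoClusters n (2 * M)) ≤
          (bondPercolation (zdGraph 2) half).real (G n (2 * M)) +
            ε * (bondPercolation (zdGraph 2) half).real (fourArmTwoClusters n M)) ∧
      (∀ n M : ℕ, n₁ ≤ n → 2 * n ≤ M →
        (bondPercolation (zdGraph 2) half).real (G n M) ≤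
          C₁ * (bondPercolation (zdGraph 2) half).real (zdFourArmOutLanded n (2 * M))))
    (hin : ∀ ε : ℝ, 0 < ε → ∃ (C₁ : ℝ) (n₁ : ℕ) (G : ℕ → ℕ → Set (BondConfig (Site 2))), 0 ≤ C₁ ∧
      (∀ m N : ℕ, n₁ ≤ m → 4 * m ≤ N →
        (bondPercolation (zdGraph 2) half).real (zdFourArmOutLanded m N) ≤
          (bondPercolation (zdGraph 2) half).real (G m N) +
            ε * (bondPercolation (zdGraph 2) half).real (zdFourArmOutLanded (2 * m) N)) ∧
      (∀ m N : ℕ, n₁ ≤ m → 4 * m ≤ N →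
        (bondPercolation (zdGraph 2) half).real (G (2 * m) N) ≤
          C₁ * (bondPercolation (zdGraph 2) half).real (zdFourArmSep m N))) :
    ∃ n₀ : ℕ, ∃ c : ℝ, 0 < c ∧ ∀ n N : ℕ, n₀ ≤ n → 2 * n ≤ N →
      c * (bondPercolation (zdGraph 2) half).real (fourArmTwoClusters n N) ≤
        (bondPercolation (zdGraph 2) half).real (zdFourArmSep n N) :=
  zdFourArm_wellSeparated_of_halves (exists_real_fourArmTwoClusters_le_mul_zdFourArmOutLanded hout) hin

/-- **DMT 2021, Prop. 6.3 for `q = 1` on `ℤ²` (cluster form) from the outer and inner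
surgery-and-landing inputs of Kesten's arm separation.** [cite: DuminilCopinManolescuTassion2021, §6.2 Prop. 6.3 (right inequality), q = 1, σ = 1010] -/
theorem DuminilCopinManolescuTassion2021_zdFourArm_quasiMult_of_outIn
    (hout : ∀ ε : ℝ, 0 < ε → ∃ (C₁ : ℝ) (n₁ : ℕ) (G : ℕ → ℕ → Set (BondConfig (Site 2))), 0 ≤ C₁ ∧
      (∀ n M : ℕ, n₁ ≤ n → n ≤ M →
        (bondPercolation (zdGraph 2) half).real (fourArmTwoClusters n (2 * M)) ≤
          (bondPercolation (zdGraph 2) half).real (G n (2 * M)) +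
            ε * (bondPercolation (zdGraph 2) half).real (fourArmTwoClusters n M)) ∧
      (∀ n M : ℕ, n₁ ≤ n → 2 * n ≤ M →
        (bondPercolation (zdGraph 2) half).real (G n M) ≤
          C₁ * (bondPercolation (zdGraph 2) half).real (zdFourArmOutLanded n (2 * M))))
    (hin : ∀ ε : ℝ, 0 < ε → ∃ (C₁ : ℝ) (n₁ : ℕ) (G : ℕ → ℕ → Set (BondConfig (Site 2))), 0 ≤ C₁ ∧
      (∀ m N : ℕ, n₁ ≤ m → 4 * m ≤ N →
        (bondPercolation (zdGraph 2) half).real (zdFourArmOutLanded m N) ≤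
          (bondPercolation (zdGraph 2) half).real (G m N) +
            ε * (bondPercolation (zdGraph 2) half).real (zdFourArmOutLanded (2 * m) N)) ∧
      (∀ m N : ℕ, n₁ ≤ m → 4 * m ≤ N →
        (bondPercolation (zdGraph 2) half).real (G (2 * m) N) ≤
          C₁ * (bondPercolation (zdGraph 2) half).real (zdFourArmSep m N))) :
    DuminilCopinManolescuTassion2021_zdFourArm_quasiMult :=
  DuminilCopinManolescuTassion2021_zdFourArm_quasiMult_of_wellSeparated (zdFourArm_wellSeparated_of_outIn hout hin)

/-- **Nolin 2008, Prop. 17 for the single-bond four-arm event on `ℤ²` from the outer and inner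
surgery-and-landing inputs of Kesten's arm separation.** [cite: Nolin2008, §4.1 and §4.5 Prop. 17 (arXiv 0711.4948: Prop. 16)] -/
theorem Nolin2008_zdEdgeFourArmQuasiMult_of_outIn
    (hout : ∀ ε : ℝ, 0 < ε → ∃ (C₁ : ℝ) (n₁ : ℕ) (G : ℕ → ℕ → Set (BondConfig (Site 2))), 0 ≤ C₁ ∧
      (∀ n M : ℕ, n₁ ≤ n → n ≤ M →
        (bondPercolation (zdGraph 2) half).real (fourArmTwoClusters n (2 * M)) ≤
          (bondPercolation (zdGraph 2) half).real (G n (2 * M)) +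
            ε * (bondPercolation (zdGraph 2) half).real (fourArmTwoClusters n M)) ∧
      (∀ n M : ℕ, n₁ ≤ n → 2 * n ≤ M →
        (bondPercolation (zdGraph 2) half).real (G n M) ≤
          C₁ * (bondPercolation (zdGraph 2) half).real (zdFourArmOutLanded n (2 * M))))
    (hin : ∀ ε : ℝ, 0 < ε → ∃ (C₁ : ℝ) (n₁ : ℕ) (G : ℕ → ℕ → Set (BondConfig (Site 2))), 0 ≤ C₁ ∧
      (∀ m N : ℕ, n₁ ≤ m → 4 * m ≤ N →
        (bondPercolation (zdGraph 2) half).real (zdFourArmOutLanded m N) ≤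
          (bondPercolation (zdGraph 2) half).real (G m N) +
            ε * (bondPercolation (zdGraph 2) half).real (zdFourArmOutLanded (2 * m) N)) ∧
      (∀ m N : ℕ, n₁ ≤ m → 4 * m ≤ N →
        (bondPercolation (zdGraph 2) half).real (G (2 * m) N) ≤
          C₁ * (bondPercolation (zdGraph 2) half).real (zdFourArmSep m N))) :
    Nolin2008_zdEdgeFourArmQuasiMult :=
  Nolin2008_zdEdgeFourArmQuasiMult_of_zdFourArm_wellSeparated (zdFourArm_wellSeparated_of_outIn hout hin)

end Literature.Probability.Percolation

end
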